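import Summits.QuantumFields.YangMills.Theorems.BalabanLadderNTCanonicalEnvelopes
import HarnessLib

/-!
# Crux `NT` (stmt-QuantumFields-19353), stub `stub_refpkgT : RefPkgT`: the CANONICAL price of the three-point floor —
# `ε₃ ≤ 8C₁³‖f‖₁‖g‖₁‖h‖₁/(δ'/4)¹²`

Helper file (`--supports stmt-QuantumFields-19353`) of the fleet lead prover of crux `NT` (unit `ym-spine-19353-p1`, GEN 13); the
three-point twin of GEN 12's `CeilingPrice.floor₂_le_canonical` (`ε₂ ≤ 4C₁²‖v‖₁²/δ⁸`), named as the «natural next» in GEN 12's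
handoff.  Hypothesis-free, general compact `G`, any `r`, any unit map `a > 0` with `a → 0`.

GEN 12's `floor₃_le_of_e1osc` prices a plain clause-(ii) floor `ε ≤ |Q3_{β,L,aβ}(f,g,h)|` (all large tori) by clause 1 through
lattice ℓ¹-envelopes `K_f, K_g, K_h`: `ε ≤ 8C₁³K_fK_gK_h/(δ'/4)¹²`.  Transporting the envelopes to `β → ∞` by GEN 12's Riemann-sum
lemma `tendsto_envelope` (`a⁴Σ|w(a x)| → ‖w‖₁`) replaces each `K` by the witness's own `L¹` norm:

* `cap₃_eq_canonical` — cap algebra `S_fS_gS_h(2C₁/R⁴)³ = (s⁴S_f)(s⁴S_g)(s⁴S_h)·8C₁³/(sR)¹²`;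
* **`floor₃_le_canonical`** — **`ε ≤ 8C₁³(∫|f|)(∫|g|)(∫|h|)/(δ'/4)¹²`** (`δ'` the pairwise support separation, `δ' ≤ 2ℓ`).

Read as a demand on the engine (memo SIZING-19353-g13 §2): `C₁ ≥ (δ'/4)⁴·(ε₃/(8‖f‖₁‖g‖₁‖h‖₁))^{1/3}`.

HONEST FRAMING.  Real arithmetic and limits over GEN 12's files; CONDITIONAL on clause 1; no floor, not AF, not NT, not the seam,
not the gap; not Clay.
-/

set_option autoImplicit false

noncomputable section

open scoped SchwartzMap
open MeasureTheory Filter Topology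
open Literature.MathematicalPhysics.QuantumFieldTheory Literature.MathematicalPhysics.QuantumLattice
open Literature.Probability.LatticeModels
open Summit.QuantumFields.YangMills.Cruxes.OSLegsFromFemtoAndGap.DlrCollarTransfer

namespace Summit.QuantumFields.YangMills.Cruxes.NT.CeilingPrice

section Cap

variable (G : Type) [Group G] [TopologicalSpace G] [IsTopologicalGroup G] [CompactSpace G]
  [MeasurableSpace G] [BorelSpace G] (r : LatticeRep G)

/-- Cap algebra: `S_fS_gS_h(2C₁/R⁴)³ = (s⁴S_f)(s⁴S_g)(s⁴S_h)·(8C₁³/(sR)¹²)`. [folklore] -/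
theorem cap₃_eq_canonical {Sf Sg Sh C₁ s R : ℝ} (hs : s ≠ 0) (hR : R ≠ 0) :
    Sf * Sg * Sh * (2 * C₁ / R ^ 4) ^ 3 = (s ^ 4 * Sf) * (s ^ 4 * Sg) * (s ^ 4 * Sh) * (8 * C₁ ^ 3 / (s * R) ^ 12) := by
  field_simp
  ring

/-- **The canonical price of the three-point floor: `ε ≤ 8C₁³‖f‖₁‖g‖₁‖h‖₁/(δ'/4)¹²`.**  Let `a > 0`, `a → 0`; assume clause 1 of
the registered package (E1-osc with `C₁ ≥ 0`, range `ℓ`, eventually in `β`) and a plain clause-(ii) floor `ε ≤ |Q3_{β,L,aβ}(f,g,h)|`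
(`β ≥ β₅`, all tori with `Λ₅ ≤ aβ·L`) for witnesses with pairwise support separation `δ' > 0`, `δ' ≤ 2ℓ`, supports in the ball of
radius `σ`.  Then `ε ≤ 8C₁³(∫|f|)(∫|g|)(∫|h|)/(δ'/4)¹²`. [folklore] -/
theorem floor₃_le_canonical (a : ℝ → ℝ) (ha : ∀ β, 0 < a β) (ha0 : Tendsto a atTop (𝓝 0)) {C₁ ℓ : ℝ} (hC₁ : 0 ≤ C₁)
    (hE1 : ∃ β₁ : ℝ, ∀ β : ℝ, β₁ ≤ β → ∀ (c : Fin 4 → ℤ) (b : ℕ), (b : ℝ) * a β ≤ ℓ →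
      ∀ (η η' : LGConfig 4 G) (x : Fin 4 → ℤ), 1 ≤ depth c b x →
        |kerE G r β c b η (dens G r x) - kerE G r β c b η' (dens G r x)| ≤ C₁ / (depth c b x : ℝ) ^ 4)
    {f g h : 𝓢(EuclideanSpace ℝ (Fin 4), ℝ)} {δ' σ : ℝ} (hδ' : 0 < δ') (hδ'ℓ : δ' ≤ 2 * ℓ)
    (hfg : ∀ p q : EuclideanSpace ℝ (Fin 4), f p ≠ 0 → g q ≠ 0 → δ' ≤ ‖p - q‖)
    (hgh : ∀ p q : EuclideanSpace ℝ (Fin 4), g p ≠ 0 → h q ≠ 0 → δ' ≤ ‖p - q‖)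
    (hfh : ∀ p q : EuclideanSpace ℝ (Fin 4), f p ≠ 0 → h q ≠ 0 → δ' ≤ ‖p - q‖)
    (hfσ : tsupport (f : EuclideanSpace ℝ (Fin 4) → ℝ) ⊆ Metric.closedBall 0 σ)
    (hgσ : tsupport (g : EuclideanSpace ℝ (Fin 4) → ℝ) ⊆ Metric.closedBall 0 σ)
    (hhσ : tsupport (h : EuclideanSpace ℝ (Fin 4) → ℝ) ⊆ Metric.closedBall 0 σ) {ε β₅ Λ₅ : ℝ}
    (hfloor : ∀ β : ℝ, β₅ ≤ β → ∀ L : ℕ, Λ₅ ≤ a β * L → ε ≤ |Q3 G r β L (a β) f g h|) :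
    ε ≤ 8 * C₁ ^ 3 * ((∫ y, |f y|) * (∫ y, |g y|) * (∫ y, |h y|)) / (δ' / 4) ^ 12 := by
  obtain ⟨β₁, H1⟩ := hE1
  -- the reference tori: carry the floor, the bulk condition and the collar of radius `⌊δ'/4/aβ⌋₊ − 2`
  set Lf : ℝ → ℕ := fun β => ⌈Λ₅ / a β⌉₊ + ⌈2 * σ / a β⌉₊ + (4 * (⌊δ' / 4 / a β⌋₊ - 2) + 8) with hLf_def
  have hLσ2 : ∀ β, 2 * σ ≤ a β * Lf β := fun β => by
    have hs := ha β
    have h1 : 2 * σ / a β ≤ ⌈2 * σ / a β⌉₊ := Nat.le_ceil _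
    have h2 : (⌈2 * σ / a β⌉₊ : ℝ) ≤ Lf β := by
      rw [hLf_def]; push_cast
      linarith [Nat.cast_nonneg (α := ℝ) ⌈Λ₅ / a β⌉₊, Nat.cast_nonneg (α := ℝ) (⌊δ' / 4 / a β⌋₊ - 2)]
    calc 2 * σ = a β * (2 * σ / a β) := by field_simp
      _ ≤ a β * Lf β := by nlinarith
  have hLΛ : ∀ β, Λ₅ ≤ a β * Lf β := fun β => by
    have hs := ha β
    have h1 : Λ₅ / a β ≤ ⌈Λ₅ / a β⌉₊ := Nat.le_ceil _
    have h2 : (⌈Λ₅ / a β⌉₊ : ℝ) ≤ Lf β := by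
      rw [hLf_def]; push_cast
      linarith [Nat.cast_nonneg (α := ℝ) ⌈2 * σ / a β⌉₊, Nat.cast_nonneg (α := ℝ) (⌊δ' / 4 / a β⌋₊ - 2)]
    calc Λ₅ = a β * (Λ₅ / a β) := by field_simp
      _ ≤ a β * Lf β := by nlinarith
  have hLσ : ∀ᶠ β in atTop, σ ≤ a β * Lf β := Eventually.of_forall fun β => by
    rcases le_or_gt 0 σ with h0 | h0
    · linarith [hLσ2 β]
    · have : 0 ≤ a β * Lf β := mul_nonneg (ha β).le (Nat.cast_nonneg _)
      linarith
  -- eventually: the cap in canonical variables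
  have hev : ∀ᶠ β in atTop, ε ≤ (a β ^ 4 * ∑ x ∈ box 4 (Lf β), |f (a β • siteToE x)|) *
      (a β ^ 4 * ∑ y ∈ box 4 (Lf β), |g (a β • siteToE y)|) * (a β ^ 4 * ∑ z ∈ box 4 (Lf β), |h (a β • siteToE z)|) *
      (8 * C₁ ^ 3 / (δ' / 4 - 3 * a β) ^ 12) := by
    have hsmall : ∀ᶠ β in atTop, a β < δ' / 4 / 3 := ha0.eventually (gt_mem_nhds (by positivity))
    filter_upwards [hsmall, eventually_ge_atTop β₁, eventually_ge_atTop β₅] with β hβs hβ1 hβ5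
    have hs : 0 < a β := ha β
    have h3 : 3 * a β < δ' / 4 := by linarith
    obtain ⟨hR1, hR2, hR3, hR4⟩ := collarRadius_spec hs h3
    have hRL : 4 * (⌊δ' / 4 / a β⌋₊ - 2) + 8 ≤ Lf β := by
      show 4 * (⌊δ' / 4 / a β⌋₊ - 2) + 8 ≤ ⌈Λ₅ / a β⌉₊ + ⌈2 * σ / a β⌉₊ + (4 * (⌊δ' / 4 / a β⌋₊ - 2) + 8)
      exact Nat.le_add_left _ _
    have hRℓ : ((2 * (⌊δ' / 4 / a β⌋₊ - 2) + 3 : ℕ) : ℝ) * a β ≤ ℓ := hR3.trans (by linarith)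
    have hRδ : 4 * ((((⌊δ' / 4 / a β⌋₊ - 2 : ℕ) : ℝ) + 2) * a β) ≤ δ' := by linarith
    have hfl := hfloor β hβ5 (Lf β) (hLΛ β)
    have hcap := abs_Q3_le_of_e1osc G r β hC₁ hs (H1 β hβ1) hfg hgh hfh hfσ hgσ hhσ (hLσ2 β) hR1 hRℓ hRL hRδ
    have hRpos : (0 : ℝ) < ((⌊δ' / 4 / a β⌋₊ - 2 : ℕ) : ℝ) := by exact_mod_cast hR1
    have hSf0 : 0 ≤ a β ^ 4 * ∑ x ∈ box 4 (Lf β), |f (a β • siteToE x)| :=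
      mul_nonneg (pow_nonneg hs.le 4) (Finset.sum_nonneg fun _ _ => abs_nonneg _)
    have hSg0 : 0 ≤ a β ^ 4 * ∑ y ∈ box 4 (Lf β), |g (a β • siteToE y)| :=
      mul_nonneg (pow_nonneg hs.le 4) (Finset.sum_nonneg fun _ _ => abs_nonneg _)
    have hSh0 : 0 ≤ a β ^ 4 * ∑ z ∈ box 4 (Lf β), |h (a β • siteToE z)| :=
      mul_nonneg (pow_nonneg hs.le 4) (Finset.sum_nonneg fun _ _ => abs_nonneg _)
    have hKK : 0 ≤ 8 * C₁ ^ 3 := mul_nonneg (by norm_num) (pow_nonneg hC₁ 3)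
    calc ε ≤ |Q3 G r β (Lf β) (a β) f g h| := hfl
      _ ≤ _ := hcap
      _ = (a β ^ 4 * ∑ x ∈ box 4 (Lf β), |f (a β • siteToE x)|) *
            (a β ^ 4 * ∑ y ∈ box 4 (Lf β), |g (a β • siteToE y)|) * (a β ^ 4 * ∑ z ∈ box 4 (Lf β), |h (a β • siteToE z)|) *
            (8 * C₁ ^ 3 / (a β * ((⌊δ' / 4 / a β⌋₊ - 2 : ℕ) : ℝ)) ^ 12) := cap₃_eq_canonical hs.ne' hRpos.ne'
      _ ≤ _ := mul_le_mul_of_nonneg_left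
            (div_le_div_of_nonneg_left hKK (pow_pos (by linarith) 12) (pow_le_pow_left₀ (by linarith) hR4 12))
            (mul_nonneg (mul_nonneg hSf0 hSg0) hSh0)
  -- the limit
  have h1 := tendsto_envelope f hfσ a Lf ha ha0 hLσ
  have h2 := tendsto_envelope g hgσ a Lf ha ha0 hLσ
  have h3 := tendsto_envelope h hhσ a Lf ha ha0 hLσ
  have h4 : Tendsto (fun β => 8 * C₁ ^ 3 / (δ' / 4 - 3 * a β) ^ 12) atTop (𝓝 (8 * C₁ ^ 3 / (δ' / 4) ^ 12)) := by
    have hd : Tendsto (fun β => (δ' / 4 - 3 * a β) ^ 12) atTop (𝓝 ((δ' / 4 - 3 * 0) ^ 12)) :=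
      (tendsto_const_nhds.sub (ha0.const_mul 3)).pow 12
    rw [mul_zero, sub_zero] at hd
    exact tendsto_const_nhds.div hd (pow_ne_zero 12 (by positivity))
  have hlim := ((h1.mul h2).mul h3).mul h4
  have e : (∫ y, |f y|) * (∫ y, |g y|) * (∫ y, |h y|) * (8 * C₁ ^ 3 / (δ' / 4) ^ 12) =
      8 * C₁ ^ 3 * ((∫ y, |f y|) * (∫ y, |g y|) * (∫ y, |h y|)) / (δ' / 4) ^ 12 := by ring
  rw [e] at hlim
  exact ge_of_tendsto hlim hev

end Cap

end Summit.QuantumFields.YangMills.Cruxes.NT.CeilingPrice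

end
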